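import Mathlib
import HarnessLib
import Summits.HubbardSuperconductivity.HubbardSuperconductivity.Theorems.KLProgrammeKLRegimeTwoVolumeDualReadout
import Summits.HubbardSuperconductivity.HubbardSuperconductivity.Theorems.KLProgrammeKLRegimeSplitFieldStrengthTimeMoment
import Summits.HubbardSuperconductivity.HubbardSuperconductivity.Theorems.KLProgrammeKLRegimeWickBubbleChannelsGeneral
import Summits.HubbardSuperconductivity.HubbardSuperconductivity.Theorems.KLProgrammeKLRegimeWickEffectiveActionLegDressing
import Literature.MathematicalPhysics.QuantumLattice.SectorisedKernelNormExtraction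
import Literature.MathematicalPhysics.QuantumLattice.GrassmannDefectSplit

/-!
# The phase-weighted rows of the dual-lattice two-leg kernel of a MOMENTUM-CONSERVING element are base-point independent — the `hrow`
# input of `…TwoVolumeDualReadout` DISCHARGED for `𝒱⁽ⁿ⁾[K] − 𝒩_K` (β′ lane, read-out half; cell gate-hubbard-kl, seat hubbard-kl-k3c5-p2 g7)

`…TwoVolumeDualReadout` reads the two-volume common-point defect (D) of the scale-`n` readings from the pinned defect of the PHASE-WEIGHTED ROWS
`R(x₀; z) = Σ_{t₁} W_σ(G)(x₀, (t₁, x⃗₀ + z))·e^{iω(t₀ − t₁)}` of the dual-lattice two-leg kernels, under the hypothesis `hrow` that the rows do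
not depend on the base point `x₀`.  Here that hypothesis is proved for every `G` whose `(+,−)` two-leg momentum kernel is DIAGONAL
(`kernel G 2 ((k,σ,+),(k′,σ,−)) = 0` for `k′ ≠ k`), with the explicit row formula
`R(x₀; z) = 2M · Σ_{k⃗} kernel G 2 (((ω,k⃗),σ,+),((ω,k⃗),σ,−))·χ_{k⃗}(z)` (`row_eq_of_diagonal`: the plane-wave pair is `e^{iω_k(t₁−t₀)}χ_{k⃗}(z)`,
`conj_phase_eq_cexp_mul_torusChar`; the time sum is Salmhofer's orthogonality `sum_imagTime_cexp`), and the diagonal hypothesis is discharged for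
the separated data `𝒱_L⁽ⁿ⁾[K] − 𝒩_K` of the model at every scale and frame (`kernel_two_offDiag_klEffectiveAction_sub_counter`: the four
conservation laws of `𝒱⁽ⁿ⁾[K]`, `kernel_two_plus_eq_zero_of_conserving`, and the explicit two-leg kernel of `𝒩_K`).  Hence
**`rows_baseIndependent_klEffectiveAction_sub_counter`** and the (D) door with `hrow` gone:
**`abs_symInterp_locRe_sub_le_frame_add_dualDefect'`** — `|S_c(q) − S_f(q)| ≤ |K_c(q) − K_f(q)| + ε·(Ddef + Dfar)` from the pinned dual
defect `Ddef` and the far fine rows `Dfar` alone.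

Proofs only; no definitions; nothing about the model is asserted beyond the displayed identities/inequalities.  References: BGM 2006 §2.1 (2.4)–(2.5),
§2.3 (2.17); Salmhofer 1999 App. B.5.5 [cite: BenfattoGiulianiMastropietro2006].
-/

noncomputable section

namespace Summit.HubbardSuperconductivity.HubbardSuperconductivity.Theorems.TwoVolumeDefect

set_option linter.dupNamespace false -- summit = problem name (single-conjunct summit), D-0017

open Finset Complex Literature.MathematicalPhysics.QuantumLattice Literature.Probability.LatticeModels GrassmannAlgebra
open Summit.HubbardSuperconductivity.HubbardSuperconductivity.Theorems.KLRegimeSplit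
open Summit.HubbardSuperconductivity.HubbardSuperconductivity.Theorems.KLProgrammeLegKernels
open Summit.HubbardSuperconductivity.HubbardSuperconductivity.Theorems.TwoLegFourier
open Summit.HubbardSuperconductivity.HubbardSuperconductivity.Theorems.KLRegimeWick
open scoped ComplexConjugate

/-! ## §1 The row formula for a diagonal two-leg kernel -/

section Rows

variable {L M : ℕ} [NeZero L] [NeZero M]

omit [NeZero M] in
/-- **The dual-lattice two-leg kernel of an element with DIAGONAL `(+,−)` momentum kernel**: `W_σ(G)(x₀, x₁) = Σ_k kernel G 2 ((k,σ,+),(k,σ,−))·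
e^{iω_k(t₁ − t₀)}·χ_{k⃗}(x⃗₁ − x⃗₀)`. -/
theorem dualKernel_two_eq_of_diagonal (β : ℝ) (G : HubbardGrassmann L M) (σ : Fin 2)
    (hdiag : ∀ k k' : FreqMomentum L M, k' ≠ k → kernel ℂ G 2 ![((k, σ), 0), ((k', σ), 1)] = 0) (x₀ x₁ : SpaceTimeIdx L M) :
    sectorisedKernel L M β (trivialMultiplier L M) G 2 (![((0, σ), 0), ((0, σ), 1)] : Fin 2 → SectorLeg 1) ![x₀, x₁] =
      ∑ k : FreqMomentum L M, kernel ℂ G 2 ![((k, σ), 0), ((k, σ), 1)] *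
        (Complex.exp (((matsubaraFreq β M k.1 * (imagTime β M x₁.1 - imagTime β M x₀.1) : ℝ) : ℂ) * I) * torusChar k.2 (x₁.2 - x₀.2)) := by
  rw [sectorisedKernel_trivialMultiplier, positionKernel]
  -- reindex the pair of momenta
  have hvec : ∀ k : Fin 2 → FreqMomentum L M, ![k 0, k 1] = k := fun k => by funext i; fin_cases i <;> rfl
  rw [← Fintype.sum_equiv (finTwoArrowEquiv (FreqMomentum L M)).symm
    (fun p : FreqMomentum L M × FreqMomentum L M => (∏ i : Fin 2, hubbardPlaneWave L M β
      ((![((0, σ), 0), ((0, σ), 1)] : Fin 2 → SectorLeg 1) i).2 ((![p.1, p.2] : Fin 2 → FreqMomentum L M) i)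
        ((![x₀, x₁] : Fin 2 → SpaceTimeIdx L M) i)) *
      kernel ℂ G 2 (fun i => ((((![p.1, p.2] : Fin 2 → FreqMomentum L M) i),
        ((![((0, σ), 0), ((0, σ), 1)] : Fin 2 → SectorLeg 1) i).1.2), ((![((0, σ), 0), ((0, σ), 1)] : Fin 2 → SectorLeg 1) i).2)))
    _ (fun p => by simp only [finTwoArrowEquiv_symm_apply])]
  rw [Fintype.sum_prod_type]
  refine sum_congr rfl fun k _ => ?_
  -- the labels of the string at the pair `(k, k')`
  have hX : ∀ k' : FreqMomentum L M, (fun i : Fin 2 => ((((![k, k'] : Fin 2 → FreqMomentum L M) i),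
      ((![((0, σ), 0), ((0, σ), 1)] : Fin 2 → SectorLeg 1) i).1.2), ((![((0, σ), 0), ((0, σ), 1)] : Fin 2 → SectorLeg 1) i).2)) =
      ![((k, σ), 0), ((k', σ), 1)] := fun k' => by funext i; fin_cases i <;> rfl
  simp_rw [hX]
  rw [Finset.sum_eq_single k (fun k' _ hk' => by rw [hdiag k k' hk', mul_zero]) (fun h => absurd (mem_univ k) h)]
  simp only [Fin.prod_univ_two, Matrix.cons_val_zero, Matrix.cons_val_one]
  rw [hubbardPlaneWave_zero_mul_one, ← conj_hubbardPlaneWave_zero_mul_one, conj_phase_eq_cexp_mul_torusChar]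
  ring

omit [NeZero M] in
/-- **THE ROW FORMULA**: for an element with diagonal `(+,−)` two-leg momentum kernel at spin `σ` (`β ≠ 0`), the phase-weighted row at ANY base
point `x₀` is `R(x₀; z) = 2M · Σ_{k⃗} kernel G 2 (((ω,k⃗),σ,+),((ω,k⃗),σ,−))·χ_{k⃗}(z)` — independent of `x₀`. -/
theorem row_eq_of_diagonal {β : ℝ} (hβ : β ≠ 0) (G : HubbardGrassmann L M) (m : MatsubaraIdx M) (σ : Fin 2)
    (hdiag : ∀ k k' : FreqMomentum L M, k' ≠ k → kernel ℂ G 2 ![((k, σ), 0), ((k', σ), 1)] = 0) (x₀ : SpaceTimeIdx L M)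
    (z : TorusSite 2 L) :
    (∑ t₁ : ImagTimeIdx M,
        sectorisedKernel L M β (trivialMultiplier L M) G 2 (![((0, σ), 0), ((0, σ), 1)] : Fin 2 → SectorLeg 1) ![x₀, (t₁, x₀.2 + z)] *
          Complex.exp (((matsubaraFreq β M m * (imagTime β M x₀.1 - imagTime β M t₁) : ℝ) : ℂ) * I)) =
      ((2 * M : ℕ) : ℂ) * ∑ kv : TorusSite 2 L, kernel ℂ G 2 ![(((m, kv), σ), 0), (((m, kv), σ), 1)] * torusChar kv z := by
  simp_rw [dualKernel_two_eq_of_diagonal β G σ hdiag, add_sub_cancel_left, sum_mul]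
  rw [sum_comm]
  -- each momentum term: the time sum is Salmhofer's orthogonality
  have hterm : ∀ k : FreqMomentum L M, ∑ t₁ : ImagTimeIdx M, kernel ℂ G 2 ![((k, σ), 0), ((k, σ), 1)] *
      (Complex.exp (((matsubaraFreq β M k.1 * (imagTime β M t₁ - imagTime β M x₀.1) : ℝ) : ℂ) * I) * torusChar k.2 z) *
        Complex.exp (((matsubaraFreq β M m * (imagTime β M x₀.1 - imagTime β M t₁) : ℝ) : ℂ) * I) =
      kernel ℂ G 2 ![((k, σ), 0), ((k, σ), 1)] * torusChar k.2 z *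
        Complex.exp (-(((matsubaraFreq β M k.1 - matsubaraFreq β M m) * imagTime β M x₀.1 : ℝ) : ℂ) * I) *
        ∑ t₁ : ImagTimeIdx M, Complex.exp (-((chargeSign 1 * ((matsubaraFreq β M k.1 - matsubaraFreq β M m) *
          imagTime β M t₁) : ℝ) : ℂ) * I) := by
    intro k
    rw [mul_sum]
    refine sum_congr rfl fun t₁ _ => ?_
    have hcs : chargeSign 1 = -1 := by unfold chargeSign; simp
    rw [hcs]
    have hexp : Complex.exp (((matsubaraFreq β M k.1 * (imagTime β M t₁ - imagTime β M x₀.1) : ℝ) : ℂ) * I) *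
        Complex.exp (((matsubaraFreq β M m * (imagTime β M x₀.1 - imagTime β M t₁) : ℝ) : ℂ) * I) =
        Complex.exp (-(((matsubaraFreq β M k.1 - matsubaraFreq β M m) * imagTime β M x₀.1 : ℝ) : ℂ) * I) *
          Complex.exp (-((-1 * ((matsubaraFreq β M k.1 - matsubaraFreq β M m) * imagTime β M t₁) : ℝ) : ℂ) * I) := by
      rw [← Complex.exp_add, ← Complex.exp_add]
      congr 1
      push_cast
      ring
    calc kernel ℂ G 2 ![((k, σ), 0), ((k, σ), 1)] *
          (Complex.exp (((matsubaraFreq β M k.1 * (imagTime β M t₁ - imagTime β M x₀.1) : ℝ) : ℂ) * I) * torusChar k.2 z) *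
          Complex.exp (((matsubaraFreq β M m * (imagTime β M x₀.1 - imagTime β M t₁) : ℝ) : ℂ) * I)
        = kernel ℂ G 2 ![((k, σ), 0), ((k, σ), 1)] * torusChar k.2 z *
          (Complex.exp (((matsubaraFreq β M k.1 * (imagTime β M t₁ - imagTime β M x₀.1) : ℝ) : ℂ) * I) *
            Complex.exp (((matsubaraFreq β M m * (imagTime β M x₀.1 - imagTime β M t₁) : ℝ) : ℂ) * I)) := by ring
      _ = _ := by rw [hexp]; ring
  simp_rw [hterm, sum_imagTime_cexp hβ 1 m]
  -- only the kept frequency `m` survives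
  rw [Fintype.sum_prod_type, mul_sum]
  rw [Finset.sum_eq_single m (fun m' _ hm' => by simp [hm']) (fun h => absurd (mem_univ m) h)]
  refine sum_congr rfl fun kv _ => ?_
  simp only [if_true, sub_self, zero_mul, Complex.ofReal_zero, neg_zero, Complex.exp_zero, mul_one]
  ring

end Rows

/-! ## §2 The diagonal hypothesis for the separated data `𝒱⁽ⁿ⁾[K] − 𝒩_K` of the model -/

section Model

variable {L M : ℕ} [NeZero L] [NeZero M]

omit [NeZero M] in
/-- **The two-leg kernel of the counterterm vertex off the diagonal vanishes**: `kernel 𝒩_K 2 ((k,σ,+),(k′,σ,−)) = 0` for `k′ ≠ k`. -/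
theorem kernel_counterQuadratic_two_offDiag (β : ℝ) (K : TrigPolyC4v) (σ : Fin 2) {k k' : FreqMomentum L M} (hk : k' ≠ k) :
    kernel ℂ (counterQuadratic L M β K) 2 (![((k, σ), 0), ((k', σ), 1)] : Fin 2 → HubbardFieldIdx L M) = 0 := by
  rw [counterQuadratic, kernel_sum]
  refine sum_eq_zero fun k'' _ => ?_
  rw [kernel_sum]
  refine sum_eq_zero fun s _ => ?_
  have hgen : psiPlus k'' s * psiMinus k'' s = genProd ℂ (![((k'', s), 0), ((k'', s), 1)] : Fin 2 → HubbardFieldIdx L M) := by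
    rw [genProd_succ, genProd_succ, genProd_zero, mul_one]
    rfl
  rw [kernel_smul, hgen, kernel_genProd, Matrix.det_fin_two]
  simp only [deltaMatrix_apply, Matrix.cons_val_zero, Matrix.cons_val_one]
  have h01 : (((k, σ), (0 : Fin 2)) : HubbardFieldIdx L M) ≠ ((k'', s), 1) := by simp
  have h10 : (((k', σ), (1 : Fin 2)) : HubbardFieldIdx L M) ≠ ((k'', s), 0) := by simp
  by_cases h00 : (((k, σ), (0 : Fin 2)) : HubbardFieldIdx L M) = ((k'', s), 0)
  · have hkk : k = k'' := by simpa using congrArg (fun p : HubbardFieldIdx L M => p.1.1) h00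
    have h11 : (((k', σ), (1 : Fin 2)) : HubbardFieldIdx L M) ≠ ((k'', s), 1) := by
      intro h
      have hk' : k' = k'' := by simpa using congrArg (fun p : HubbardFieldIdx L M => p.1.1) h
      exact hk (hk'.trans hkk.symm)
    rw [if_pos h00, if_neg h11, if_neg h01, if_neg h10]
    simp
  · rw [if_neg h00, if_neg h01, if_neg h10]
    simp

/-- **The separated data of the model have a DIAGONAL `(+,−)` two-leg kernel** at every scale `n` and frame `K`:
`kernel (𝒱⁽ⁿ⁾[K] − 𝒩_K) 2 ((k,σ,+),(k′,σ,−)) = 0` for `k′ ≠ k` (the four conservation laws of `𝒱⁽ⁿ⁾[K]` and the explicit counterterm kernel). -/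
theorem kernel_two_offDiag_klEffectiveAction_sub_counter (β U μ : ℝ) (K : TrigPolyC4v) (n : ℕ) (σ : Fin 2)
    (k k' : FreqMomentum L M) (hk : k' ≠ k) :
    kernel ℂ (klEffectiveAction L M β U μ K klE0 n - counterQuadratic L M β K) 2 ![((k, σ), 0), ((k', σ), 1)] = 0 := by
  rw [TwoLegFourier.kernel_sub', kernel_counterQuadratic_two_offDiag β K σ hk, sub_zero]
  exact kernel_two_plus_eq_zero_of_conserving (klEffectiveAction L M β U μ K klE0 n)
    (fun m X h => kernel_klEffectiveAction_eq_zero_of_charge β U μ K klE0 n h)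
    (fun m X h => kernel_klEffectiveAction_eq_zero_of_freq β U μ K klE0 n h)
    (fun m X h => kernel_klEffectiveAction_eq_zero_of_spin β U μ K klE0 n h)
    (fun m X j h => kernel_klEffectiveAction_eq_zero_of_momentum β U μ K klE0 n j h) k σ
    (fun h => hk (by simpa using h))

/-- **`hrow` DISCHARGED FOR THE MODEL**: the phase-weighted rows of the dual-lattice two-leg kernels of `𝒱_L⁽ⁿ⁾[K] − 𝒩_K` are base-point
independent (every volume, scale, frame, kept frequency, spin; `β ≠ 0`). -/
theorem rows_baseIndependent_klEffectiveAction_sub_counter {β : ℝ} (hβ : β ≠ 0) (U μ : ℝ) (K : TrigPolyC4v) (n : ℕ)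
    (m : MatsubaraIdx M) (σ : Fin 2) (x₀ x₀' : SpaceTimeIdx L M) (z : TorusSite 2 L) :
    (∑ t₁ : ImagTimeIdx M,
        sectorisedKernel L M β (trivialMultiplier L M) (klEffectiveAction L M β U μ K klE0 n - counterQuadratic L M β K) 2
            (![((0, σ), 0), ((0, σ), 1)] : Fin 2 → SectorLeg 1) ![x₀, (t₁, x₀.2 + z)] *
          Complex.exp (((matsubaraFreq β M m * (imagTime β M x₀.1 - imagTime β M t₁) : ℝ) : ℂ) * I)) =
      ∑ t₁ : ImagTimeIdx M,
        sectorisedKernel L M β (trivialMultiplier L M) (klEffectiveAction L M β U μ K klE0 n - counterQuadratic L M β K) 2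
            (![((0, σ), 0), ((0, σ), 1)] : Fin 2 → SectorLeg 1) ![x₀', (t₁, x₀'.2 + z)] *
          Complex.exp (((matsubaraFreq β M m * (imagTime β M x₀'.1 - imagTime β M t₁) : ℝ) : ℂ) * I) := by
  rw [row_eq_of_diagonal hβ _ m σ (kernel_two_offDiag_klEffectiveAction_sub_counter β U μ K n σ) x₀ z,
    row_eq_of_diagonal hβ _ m σ (kernel_two_offDiag_klEffectiveAction_sub_counter β U μ K n σ) x₀' z]

end Model

/-! ## §3 The (D) door of `…TwoVolumeDualReadout` with `hrow` discharged -/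

section Door

variable {Lc Lf b M : ℕ} [NeZero Lc] [NeZero Lf] [NeZero M]

/-- **(D) OF THE SPLIT DOOR FROM THE DUAL-LATTICE TWO-LEG DEFECT ALONE**, every scale `n`, two frames (`…TwoVolumeDualReadout`'s
`abs_symInterp_locRe_sub_le_frame_add_dualDefect` with the row-invariance hypotheses discharged by `rows_baseIndependent_klEffectiveAction_sub_counter`):
volumes `Lf = b·Lc`, common `M`, `0 < β`, frames under the degree guards, pins `o_c`, `o_f`; from the pinned row defect through the centred lift
(`Ddef`, four strings, both offset signs) and the far fine rows (`Dfar`):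
`|S_c(q) − S_f(q)| ≤ |K_c(q) − K_f(q)| + ε·(Ddef + Dfar)` at every continuum point `q`. -/
theorem abs_symInterp_locRe_sub_le_frame_add_dualDefect' (hL : Lf = b * Lc) {β : ℝ} (hβ : 0 < β) (U μ : ℝ) {Kc Kf : TrigPolyC4v}
    (hdegc : Kc.degree ≤ Lc / 2) (hdegf : Kf.degree ≤ Lf / 2) (n : ℕ) (oc : SpaceTimeIdx Lc M) (of : SpaceTimeIdx Lf M) {Ddef Dfar : ℝ}
    (hdef : ∀ m ∈ ({omega0 M, (omega0 M).rev} : Finset (MatsubaraIdx M)), ∀ σ : Fin 2, ∑ ybar : TorusSite 2 Lc,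
      (‖(∑ t₁ : ImagTimeIdx M,
          sectorisedKernel Lc M β (trivialMultiplier Lc M) (klEffectiveAction Lc M β U μ Kc klE0 n - counterQuadratic Lc M β Kc) 2
              (![((0, σ), 0), ((0, σ), 1)] : Fin 2 → SectorLeg 1) ![oc, (t₁, oc.2 + ybar)] *
            Complex.exp (((matsubaraFreq β M m * (imagTime β M oc.1 - imagTime β M t₁) : ℝ) : ℂ) * I)) -
        (∑ t₁ : ImagTimeIdx M,
          sectorisedKernel Lf M β (trivialMultiplier Lf M) (klEffectiveAction Lf M β U μ Kf klE0 n - counterQuadratic Lf M β Kf) 2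
              (![((0, σ), 0), ((0, σ), 1)] : Fin 2 → SectorLeg 1) ![of, (t₁, of.2 + Torus.proj Lf (Torus.cRep ybar))] *
            Complex.exp (((matsubaraFreq β M m * (imagTime β M of.1 - imagTime β M t₁) : ℝ) : ℂ) * I))‖ +
      ‖(∑ t₁ : ImagTimeIdx M,
          sectorisedKernel Lc M β (trivialMultiplier Lc M) (klEffectiveAction Lc M β U μ Kc klE0 n - counterQuadratic Lc M β Kc) 2
              (![((0, σ), 0), ((0, σ), 1)] : Fin 2 → SectorLeg 1) ![oc, (t₁, oc.2 + -ybar)] *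
            Complex.exp (((matsubaraFreq β M m * (imagTime β M oc.1 - imagTime β M t₁) : ℝ) : ℂ) * I)) -
        (∑ t₁ : ImagTimeIdx M,
          sectorisedKernel Lf M β (trivialMultiplier Lf M) (klEffectiveAction Lf M β U μ Kf klE0 n - counterQuadratic Lf M β Kf) 2
              (![((0, σ), 0), ((0, σ), 1)] : Fin 2 → SectorLeg 1) ![of, (t₁, of.2 + -Torus.proj Lf (Torus.cRep ybar))] *
            Complex.exp (((matsubaraFreq β M m * (imagTime β M of.1 - imagTime β M t₁) : ℝ) : ℂ) * I))‖) ≤ Ddef)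
    (hfar : ∀ m ∈ ({omega0 M, (omega0 M).rev} : Finset (MatsubaraIdx M)), ∀ σ : Fin 2,
      ∑ y ∈ univ.filter (fun y : TorusSite 2 Lf => Torus.proj Lf (Torus.cRep (fun i => (((y i).val : ℕ) : ZMod Lc))) ≠ y),
      (‖(∑ t₁ : ImagTimeIdx M,
          sectorisedKernel Lf M β (trivialMultiplier Lf M) (klEffectiveAction Lf M β U μ Kf klE0 n - counterQuadratic Lf M β Kf) 2
              (![((0, σ), 0), ((0, σ), 1)] : Fin 2 → SectorLeg 1) ![of, (t₁, of.2 + y)] *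
            Complex.exp (((matsubaraFreq β M m * (imagTime β M of.1 - imagTime β M t₁) : ℝ) : ℂ) * I))‖ +
      ‖(∑ t₁ : ImagTimeIdx M,
          sectorisedKernel Lf M β (trivialMultiplier Lf M) (klEffectiveAction Lf M β U μ Kf klE0 n - counterQuadratic Lf M β Kf) 2
              (![((0, σ), 0), ((0, σ), 1)] : Fin 2 → SectorLeg 1) ![of, (t₁, of.2 + -y)] *
            Complex.exp (((matsubaraFreq β M m * (imagTime β M of.1 - imagTime β M t₁) : ℝ) : ℂ) * I))‖) ≤ Dfar)
    (q : Fin 2 → ℝ) :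
    |(symInterp Lc (klLocSelfEnergyRe Lc M β U μ Kc n)).eval q - (symInterp Lf (klLocSelfEnergyRe Lf M β U μ Kf n)).eval q| ≤
      |Kc.eval q - Kf.eval q| + imagTimeWeight β M * (Ddef + Dfar) :=
  abs_symInterp_locRe_sub_le_frame_add_dualDefect hL hβ U μ hdegc hdegf n oc of
    (fun m _ σ x₀ x₀' z => rows_baseIndependent_klEffectiveAction_sub_counter hβ.ne' U μ Kc n m σ x₀ x₀' z)
    (fun m _ σ x₀ x₀' z => rows_baseIndependent_klEffectiveAction_sub_counter hβ.ne' U μ Kf n m σ x₀ x₀' z) hdef hfar q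

end Door

end Summit.HubbardSuperconductivity.HubbardSuperconductivity.Theorems.TwoVolumeDefect

end
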